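import Summits.QuantumFields.GaugeBoot.DiagonalRPTorusUnitaryCharacter
import Summits.QuantumFields.GaugeBoot.DiagonalRPTorusInnerHalfNegativeEvenSUN
import Literature.MathematicalPhysics.QuantumFieldTheory.LatticeGaugeAsymptoticsFreeEnergyProofs
import HarnessLib

/-!
# Torus diagonal RP fails in three dimensions for `G ≅ U(N)` (`U(1)` included) at small coupling
(gauge-boot, task L3(π), supplement 3/3)

HONEST FRAMING (cell `pub-gaugeboot`, page 1 of every file): the venture produces certified bounds
on lattice expectations at stated coupling, gauge group, dimension and torus size; NOT a mass gap,
NOT a continuum limit, NOT a string tension; NOT Yang–Mills-summit-bearing (barriers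
`FixedCouplingUltralocality`, `PerturbativeInvisibility`). This module is a structural NEGATIVE
result about which positivity constraints a TORUS certificate may use (the venture's `U(N)`
two-dimensional rows and `U(1)` = compact lattice QED are covered by the same statement); it
discharges nothing else.

## Content (torus `(ℤ/L)³`, `G ≅ U(N)` through `IsUnitaryModel ρ`, every `N ≥ 1`)

The abstract theorems `DiagRPSUN.not_diagonalReflectionPositive_odd_of_moments` (L3(ξ)) and
`DiagRPSUN.not_innerDiagonalRP_even_of_moments` (L3(π)) need a centre element `ρ z₀ = ω • 1`,
`ω ≠ 1`, and the character identities (R1), (R2) with positive constants; for `G ≅ U(N)` these are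
`z₀ = ρ⁻¹(-1)`, `c₁ = 1/(2N)`, `c₂ = 1/N` (`DiagonalRPTorusUnitaryMoments`,
`DiagonalRPTorusUnitaryCharacter`). Hence:

* **`not_diagonalReflectionPositive_odd_unitary`** — closed-half diagonal RP fails on every odd
  three-torus `L ≥ 3`, for all `0 < β ≤ β₀(L, N)`;
* **`not_innerDiagonalRP_even_unitary`** — inner-half diagonal RP fails on every even three-torus
  `L ≥ 6`, for all `0 < β ≤ β₀(L, N)`;
* the concrete instances **`not_diagonalReflectionPositive_odd_uN`**,
  **`not_innerDiagonalRP_even_uN`** (via the tree's `isUnitaryModel_unitaryFundamentalRep`) for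
  `Matrix.unitaryGroup (Fin N) ℂ`, `N ≥ 1`, with its defining representation — `N = 1` is compact
  `U(1)` lattice gauge theory (not vacuous).

The window `β₀` depends on `L`, `N` (existential). Elementary strong-coupling expansion; not in
print as far as the cell's searches go.
-/

open MeasureTheory Complex Finset Function
open scoped ComplexOrder

namespace Summit.QuantumFields.GaugeBoot

open Literature.MathematicalPhysics.QuantumFieldTheory
open Literature.MathematicalPhysics.QuantumFieldTheory.PlaquetteLowerBound (reTr)
open Literature.RepresentationTheory.CompactGroups

noncomputable section

namespace DiagRPSUN

open DiagRPThree DiagRPPolyakov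

/-! ## Abstract `G ≅ U(N)` -/

section Unitary

variable {L : ℕ} [NeZero L] {N : ℕ} {G : Type*} [Group G] [TopologicalSpace G]
  [IsTopologicalGroup G] [CompactSpace G] [MeasurableSpace G] [BorelSpace G]
  [SecondCountableTopology G] (ρ : G →* Matrix (Fin N) (Fin N) ℂ)

/-- ★★ **Closed-half diagonal RP fails on every odd three-torus for `G ≅ U(N)` at small
coupling** (`N ≥ 1`, `L ≥ 3` odd; `β₀ = β₀(L, N)`). -/
theorem not_diagonalReflectionPositive_odd_unitary (hρ : IsUnitaryModel ρ) (hN : 1 ≤ N)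
    (hLodd : Odd L) (h3 : 3 ≤ L) :
    ∃ β₀ : ℝ, 0 < β₀ ∧ ∀ β : ℝ, 0 < β → β ≤ β₀ →
      ¬ DiagonalReflectionPositive (d := 3) (L := L) ρ β 0 1 := by
  obtain ⟨z₀, ω, hω, hz₀⟩ := exists_smul_one_unitary ρ hρ
  have hNpos : (0 : ℝ) < N := by exact_mod_cast hN
  exact not_diagonalReflectionPositive_odd_of_moments ρ hLodd h3 hρ.1 hN hz₀ hω
    (c₁ := (2 * N : ℝ)⁻¹) (by positivity) (inv_pos.2 hNpos)
    (integral_re_trace_mul_inv_mul_unitary ρ hρ) (integral_re_trace_conj_mul_unitary ρ hρ)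

/-- ★★ **Inner-half diagonal RP fails on every even three-torus `L ≥ 6` for `G ≅ U(N)` at small
coupling** (`N ≥ 1`; `β₀ = β₀(L, N)`). -/
theorem not_innerDiagonalRP_even_unitary (hρ : IsUnitaryModel ρ) (hN : 1 ≤ N)
    (hLeven : Even L) (h6 : 6 ≤ L) :
    ∃ β₀ : ℝ, 0 < β₀ ∧ ∀ β : ℝ, 0 < β → β ≤ β₀ →
      ¬ InnerDiagonalRP (d := 3) (L := L) ρ β 0 1 := by
  obtain ⟨z₀, ω, hω, hz₀⟩ := exists_smul_one_unitary ρ hρ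
  have hNpos : (0 : ℝ) < N := by exact_mod_cast hN
  exact not_innerDiagonalRP_even_of_moments ρ hLeven h6 hρ.1 hN hz₀ hω
    (c₁ := (2 * N : ℝ)⁻¹) (by positivity) (inv_pos.2 hNpos)
    (integral_re_trace_mul_inv_mul_unitary ρ hρ) (integral_re_trace_conj_mul_unitary ρ hρ)

/-- The back-gauge-invariant closed-half statement fails as well on even tori. -/
theorem not_backInvariantDiagonalRP_even_unitary (hρ : IsUnitaryModel ρ) (hN : 1 ≤ N)
    (hLeven : Even L) (h6 : 6 ≤ L) :
    ∃ β₀ : ℝ, 0 < β₀ ∧ ∀ β : ℝ, 0 < β → β ≤ β₀ →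
      ¬ BackInvariantDiagonalRP (d := 3) (L := L) ρ β 0 1 := by
  obtain ⟨β₀, hβ₀, h⟩ := not_innerDiagonalRP_even_unitary ρ hρ hN hLeven h6
  exact ⟨β₀, hβ₀, fun β hβ hβ1 hB => h β hβ hβ1 hB.innerDiagonalRP⟩

end Unitary

/-! ## The concrete groups `U(N)`, `N ≥ 1` -/

section UN

open Literature.MathematicalPhysics.QuantumLattice

/-- ★★ **`U(N)` lattice gauge theory (`N ≥ 1`; `N = 1`: compact `U(1)`) violates closed-half
diagonal RP on every odd three-torus `(ℤ/L)³`, `L ≥ 3`, for all sufficiently small `β > 0`**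
(not vacuous). -/
theorem not_diagonalReflectionPositive_odd_uN {L N : ℕ} [NeZero L] (hN : 1 ≤ N) (hLodd : Odd L)
    (h3 : 3 ≤ L) :
    ∃ β₀ : ℝ, 0 < β₀ ∧ ∀ β : ℝ, 0 < β → β ≤ β₀ →
      ¬ DiagonalReflectionPositive (d := 3) (L := L) (unitaryFundamentalRep (Fin N) ℂ) β 0 1 := by
  haveI : SecondCountableTopology (Matrix.unitaryGroup (Fin N) ℂ) :=
    IsUnitaryModel.secondCountableTopology _ (isUnitaryModel_unitaryFundamentalRep N)
  exact not_diagonalReflectionPositive_odd_unitary (unitaryFundamentalRep (Fin N) ℂ)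
    (isUnitaryModel_unitaryFundamentalRep N) hN hLodd h3

/-- ★★ **`U(N)` lattice gauge theory (`N ≥ 1`; `N = 1`: compact `U(1)`) violates inner-half
diagonal RP on every even three-torus `(ℤ/L)³`, `L ≥ 6`, for all sufficiently small `β > 0`**
(not vacuous). -/
theorem not_innerDiagonalRP_even_uN {L N : ℕ} [NeZero L] (hN : 1 ≤ N) (hLeven : Even L)
    (h6 : 6 ≤ L) :
    ∃ β₀ : ℝ, 0 < β₀ ∧ ∀ β : ℝ, 0 < β → β ≤ β₀ →
      ¬ InnerDiagonalRP (d := 3) (L := L) (unitaryFundamentalRep (Fin N) ℂ) β 0 1 := by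
  haveI : SecondCountableTopology (Matrix.unitaryGroup (Fin N) ℂ) :=
    IsUnitaryModel.secondCountableTopology _ (isUnitaryModel_unitaryFundamentalRep N)
  exact not_innerDiagonalRP_even_unitary (unitaryFundamentalRep (Fin N) ℂ)
    (isUnitaryModel_unitaryFundamentalRep N) hN hLeven h6

end UN

end DiagRPSUN

end

end Summit.QuantumFields.GaugeBoot
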